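/-
Copyright (c) 2026. All rights reserved.
Released under Apache 2.0 license as described in the file LICENSE.
Authors: abc-iut cell, campaign-S prover seat abc-iut-S8 (wave 2).
-/
import Mathlib.Analysis.Normed.Group.Pointwise
import Mathlib.Data.Set.Card
import Literature.IUT.LogVolume.UnitGroupVolume
import Literature.IUT.LogVolume.UnitLogFibres
import Literature.IUT.LogVolume.LogShellTopology
import HarnessLib

/-!
# [IUTchIV] Prop. 1.4 (ii): the Haar count `μ_k(log_p(R^×)) · #R^μ = μ_k(R^×)`

Mochizuki, *Inter-universal Teichmüller theory IV*, RIMS manuscript (Apr. 2020; = PRIMS **57** (2021)),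
§1, Proposition 1.4 (ii), kurims p. 13: "`μ^log(log_p(R_i^×)) = −(1/e_i + m_i/(e_i f_i))·log(p)`",
where (p. 13) "`R^μ_i ⊆ R^×_i` [is] the torsion subgroup of `R^×_i`, `R^{×μ}_i := R^×_i/R^μ_i`, `p^{f_i}`
the cardinality of the residue field of `k_i`, and `p^{m_i}` the order of the `p`-primary component of
`R^μ_i`".  The printed proof (pp. 13–14) observes that "the log-volume on `R^×_i` determines, in a natural
way, a log-volume on the quotient `R^×_i ↠ R^{×μ}_i`", that by "the compatibility of the log-volume
with `log_p(−)` [cf. [AbsTopIII], Proposition 5.7, (i), (c)] … `μ^log(log_p(R^×_i)) = μ^log(R^{×μ}_i)`",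
and finally "`e_i·f_i·μ^log(R^{×μ}_i) = e_i·f_i·μ^log(R^×_i) − log(p^{m_i}·(p^{f_i} − 1))`" — i.e. the
VOLUME IDENTITY
  `μ_k(log_p(R^×)) · #R^μ = μ_k(R^×)`                                                   (∗)
for the `O_k`-normalised Haar measure `μ_k` of the cell's `LocalFieldVolume.lean` (abc-iut-S2).

This file PROVES (∗) for every `K` in the cell's norm-side MLF setting
(`[NormedAlgebra ℚ_[p] K] [IsUltrametricDist K] [ProperSpace K]`), by making the quoted sentences
concrete with the uniform radius `ρ = p⁻²` of `LogShellTopology.lean` (abc-iut-S1):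
* both `R^× = {‖u‖ = 1}` and `log_p(R^×)` (`logUnits K`, `LocalUnitLog.lean`) are finite disjoint unions
  of closed `ρ`-balls, so their volumes are (number of balls) `× μ_k({‖z‖ ≤ ρ})`
  (`localVolume_eq_ncard_mul`);
* `log_p` maps the ball `u + {‖z‖ ≤ ρ} = u·(1 + p²R)` ONTO the ball `log_p(u) + {‖z‖ ≤ ρ}`
  (`unitLog_image_closedBall`; `logSeries_image_closedBall` of `LogSeriesEstimates.lean`) — this is the
  "compatibility of the log-volume with `log_p`" used in the proof;
* two such image balls coincide iff the centres differ by an element of `R^μ`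
  (`unitLog_sub_norm_le_iff`, `UnitLogFibres.lean`), and `R^μ ∩ (1 + p²R) = {1}`, so every fibre of the
  induced map on balls has exactly `#R^μ` elements (`fibre_eq_image_torsion`, `injOn_torsion_ball`) —
  this is "the log-volume on the quotient `R^× ↠ R^{×μ}`".
Consequences recorded here: `R^μ = {ζ : IsTorsionUnit K ζ}` is FINITE (`finite_isTorsionUnit`, a
by-product of the count) and (∗) = `localVolume_logUnits_mul_ncard_torsion`, with its real form.
The printed closed form `μ^log(log_p(R^×)) = −(1/e + m/(ef))·log p` follows from (∗) with
`μ_k(R^×) = 1 − p^{−f}` (`UnitGroupVolume.lean`, abc-iut-S2) and `#R^μ = p^m·(p^f − 1)`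
(`TorsionUnits.lean`, abc-iut-S1) and is assembled in the sequel file once the latter lands.
Classical `p`-adic measure theory; the [IUTchIV] locators record which printed lines are being
kernel-checked; nothing here bears on the disputed [IUTchIII] Cor. 3.12.
-/

noncomputable section

open MeasureTheory Set Metric
open scoped ENNReal Pointwise NormedField

namespace Literature.IUT.LogVolume

/-! ## Finite disjoint unions of `ρ`-balls in an ultrametric proper field -/

section Balls

variable (K : Type*) [NontriviallyNormedField K] [IsUltrametricDist K] [ProperSpace K]

omit [ProperSpace K] in
/-- The closed `ρ`-balls centred in a compact set `A` form a FINITE set of subsets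
(`ρ > 0`; ultrametric: a ball is determined by any of its points, and finitely many cover `A`).
[cite: MochizukiAbsTopIII2015, Prop. 5.7 (i)(a) p. 137] -/
theorem finite_image_closedBall {A : Set K} (hA : IsCompact A) {ρ : ℝ} (hρ : 0 < ρ) :
    ((fun x : K ↦ closedBall x ρ) '' A).Finite := by
  obtain ⟨t, ht⟩ := hA.elim_finite_subcover (fun x : K ↦ closedBall x ρ)
    (fun x ↦ IsUltrametricDist.isOpen_closedBall x hρ.ne')
    (fun x _ ↦ mem_iUnion.mpr ⟨x, mem_closedBall_self hρ.le⟩)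
  refine (t.finite_toSet.image (fun x : K ↦ closedBall x ρ)).subset ?_
  rintro _ ⟨y, hy, rfl⟩
  obtain ⟨x, hx, hyx⟩ : ∃ x ∈ t, y ∈ closedBall x ρ := by simpa using ht hy
  exact ⟨x, hx, IsUltrametricDist.closedBall_eq_of_mem hyx⟩

omit [ProperSpace K] in
/-- Distinct closed `ρ`-balls are disjoint (ultrametric). [cite: MochizukiAbsTopIII2015, Prop. 5.7 (i)(a) p. 137] -/
theorem pairwiseDisjoint_image_closedBall (A : Set K) (ρ : ℝ) :
    ((fun x : K ↦ closedBall x ρ) '' A).PairwiseDisjoint id := by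
  rintro _ ⟨x, -, rfl⟩ _ ⟨y, -, rfl⟩ hne
  exact (IsUltrametricDist.closedBall_eq_or_disjoint (x := x) (y := y) (r := ρ)).resolve_left hne

omit [IsUltrametricDist K] [ProperSpace K] in
/-- A set which contains the `ρ`-ball around each of its points is the union of those balls.
[cite: MochizukiAbsTopIII2015, Prop. 5.7 (i)(a) p. 137] -/
theorem sUnion_image_closedBall {A : Set K} {ρ : ℝ} (hρ : 0 ≤ ρ)
    (hsat : ∀ x ∈ A, closedBall x ρ ⊆ A) : ⋃₀ ((fun x : K ↦ closedBall x ρ) '' A) = A := by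
  apply subset_antisymm
  · rintro y ⟨_, ⟨x, hx, rfl⟩, hy⟩
    exact hsat x hx hy
  · intro x hx
    exact ⟨closedBall x ρ, ⟨x, hx, rfl⟩, mem_closedBall_self hρ⟩

variable [MeasurableSpace K] [BorelSpace K]

/-- **Volume of a finite disjoint union of `ρ`-balls**: if the compact set `A` contains the `ρ`-ball
(`ρ > 0`) around each of its points, then `μ_k(A) = #{ρ-balls in A} · μ_k({‖z‖ ≤ ρ})` (additivity and
translation invariance of `μ_k`). [cite: MochizukiAbsTopIII2015, Prop. 5.7 (i)(a) p. 137] -/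
theorem localVolume_eq_ncard_mul {A : Set K} (hA : IsCompact A) {ρ : ℝ} (hρ : 0 < ρ)
    (hsat : ∀ x ∈ A, closedBall x ρ ⊆ A) :
    localVolume K A =
      ((fun x : K ↦ closedBall x ρ) '' A).ncard * localVolume K (closedBall (0 : K) ρ) := by
  classical
  have hfin := finite_image_closedBall K hA hρ
  set F := hfin.toFinset with hF
  have hAU : A = ⋃ β ∈ F, id β := by
    rw [← sUnion_image_closedBall K hρ.le hsat, sUnion_eq_biUnion]
    simp [hF]
  have hdisj : (F : Set (Set K)).PairwiseDisjoint id := by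
    rw [hF, Finite.coe_toFinset]
    exact pairwiseDisjoint_image_closedBall K A ρ
  have hmeas : ∀ β ∈ F, MeasurableSet (id β) := by
    intro β hβ
    obtain ⟨x, -, rfl⟩ := (hfin.mem_toFinset).mp hβ
    exact measurableSet_closedBall
  have hvol : ∀ β ∈ F, localVolume K (id β) = localVolume K (closedBall (0 : K) ρ) := by
    intro β hβ
    obtain ⟨x, -, rfl⟩ := (hfin.mem_toFinset).mp hβ
    change localVolume K (closedBall x ρ) = _
    rw [← vadd_closedBall_zero, localVolume_vadd]
  have h1 : localVolume K A = ∑ β ∈ F, localVolume K (id β) := by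
    conv_lhs => rw [hAU]
    exact measure_biUnion_finset hdisj hmeas
  rw [h1, Finset.sum_congr rfl hvol, Finset.sum_const, nsmul_eq_mul,
    Set.ncard_eq_toFinset_card _ hfin]

end Balls

/-! ## `log_p` on `ρ`-balls, `ρ = p⁻²` -/

section Log

variable (p : ℕ) [Fact p.Prime]
variable (K : Type*) [NontriviallyNormedField K] [instK : NormedAlgebra ℚ_[p] K] [IsUltrametricDist K]
  [ProperSpace K]

/-- The uniform radius `ρ = p⁻²` is positive. [cite: Koblitz1984, Ch. IV §1] -/
private theorem rho_pos : (0 : ℝ) < (p : ℝ) ^ (-(2 : ℝ)) :=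
  Real.rpow_pos_of_pos (by exact_mod_cast (Fact.out : p.Prime).pos) _

/-- The uniform radius `ρ = p⁻²` is `< 1`. [cite: Koblitz1984, Ch. IV §1] -/
private theorem rho_lt_one : (p : ℝ) ^ (-(2 : ℝ)) < 1 :=
  Real.rpow_lt_one_of_one_lt_of_neg (by exact_mod_cast (Fact.out : p.Prime).one_lt) (by norm_num)

omit instK [ProperSpace K] in
/-- A point at distance `< 1` from a unit is a unit (ultrametric).
[cite: NeukirchANT1999, Ch. II (5.5)] -/
theorem norm_eq_one_of_norm_sub_lt_one {u y : K} (hu : ‖u‖ = 1) (h : ‖y - u‖ < 1) : ‖y‖ = 1 := by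
  have h1 : ‖y‖ ≤ 1 := by
    have := IsUltrametricDist.norm_add_le_max (y - u) u
    rw [sub_add_cancel] at this
    exact this.trans (max_le h.le hu.le)
  rcases h1.lt_or_eq with hlt | heq
  · exfalso
    have := IsUltrametricDist.norm_add_le_max (u - y) y
    rw [sub_add_cancel, hu, norm_sub_rev] at this
    exact absurd this (not_le.mpr (max_lt h hlt))
  · exact heq

omit instK [ProperSpace K] in
/-- `R^× = {‖u‖ = 1}` contains the `p⁻²`-ball around each of its points.
[cite: NeukirchANT1999, Ch. II (5.5)] -/
theorem closedBall_subset_sphere {u : K} (hu : ‖u‖ = 1) :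
    closedBall u ((p : ℝ) ^ (-(2 : ℝ))) ⊆ sphere (0 : K) 1 := by
  intro y hy
  rw [mem_closedBall, dist_eq_norm] at hy
  rw [mem_sphere_zero_iff_norm]
  exact norm_eq_one_of_norm_sub_lt_one K hu (hy.trans_lt (rho_lt_one p))

include instK in
/-- `log_p(R^×)` contains the `p⁻²`-ball around each of its points (it is an additive subgroup
containing `{‖z‖ ≤ p⁻²}`, `closedBall_subset_logUnits`). [claim: Mochizuki2012, status: disputed] -/
theorem closedBall_subset_logUnits_of_mem {z : K} (hz : z ∈ logUnits K) :
    closedBall z ((p : ℝ) ^ (-(2 : ℝ))) ⊆ logUnits K := by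
  intro w hw
  rw [mem_closedBall, dist_eq_norm] at hw
  have h1 : w - z ∈ logUnits K := closedBall_subset_logUnits p K (by exact hw)
  have h2 : (w - z) + z ∈ (logUnitsAddSubgroup p K : Set K) :=
    (logUnitsAddSubgroup p K).add_mem h1 hz
  simpa using h2

include instK in
/-- **`log_p` maps the ball `u + {‖z‖ ≤ p⁻²} = u·(1 + p²R)` onto the ball `log_p(u) + {‖z‖ ≤ p⁻²}`**
(`u` a unit): into by the Lipschitz bound `‖log_p y − log_p u‖ ≤ ‖y − u‖`, onto because
`L(1 + p²R) = p²R` (`logSeries_image_closedBall`) and `log_p(w·u) = L(w) + log_p(u)`.  This is the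
"compatibility of the log-volume with `log_p(−)`" invoked in the proof of [IUTchIV] Prop. 1.4 (ii)
(p. 14). [cite: Mochizuki2012, IUTchIV Prop. 1.4 (ii) proof p. 14] -/
theorem unitLog_image_closedBall {u : K} (hu : ‖u‖ = 1) :
    unitLog '' closedBall u ((p : ℝ) ^ (-(2 : ℝ))) = closedBall (unitLog u) ((p : ℝ) ^ (-(2 : ℝ))) := by
  have hθ := rpow_neg_two_mul_lt_one p
  have hu0 : u ≠ 0 := norm_pos_iff.mp (by rw [hu]; exact one_pos)
  apply subset_antisymm
  · rintro _ ⟨y, hy, rfl⟩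
    rw [mem_closedBall, dist_eq_norm] at hy ⊢
    exact (norm_unitLog_sub_le p K hu hy).trans hy
  · intro z hz
    rw [mem_closedBall, dist_eq_norm] at hz
    obtain ⟨w, hw, hwz⟩ := exists_logSeries_eq p K hθ hz
    have hwP : IsPrincipal w := hw.trans_lt (rho_lt_one p)
    have hw1 : ‖w‖ = 1 := hwP.norm_eq_one
    refine ⟨w * u, ?_, ?_⟩
    · rw [mem_closedBall, dist_eq_norm, show w * u - u = -((1 - w) * u) by ring, norm_neg, norm_mul,
        hu, mul_one]
      exact hw
    · rw [unitLog_mul p hw1 hu, unitLog_of_isPrincipal p hwP, hwz, sub_add_cancel]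

include instK in
/-- The induced map on balls: `β ↦ log_p(β)` carries the `p⁻²`-balls of `R^×` ONTO the `p⁻²`-balls of
`log_p(R^×)`. [cite: Mochizuki2012, IUTchIV Prop. 1.4 (ii) proof p. 14] -/
theorem image_unitLog_image_balls :
    (fun β : Set K ↦ unitLog '' β) '' ((fun x : K ↦ closedBall x ((p : ℝ) ^ (-(2 : ℝ)))) '' sphere (0 : K) 1)
      = (fun x : K ↦ closedBall x ((p : ℝ) ^ (-(2 : ℝ)))) '' logUnits K := by
  apply subset_antisymm
  · rintro _ ⟨_, ⟨u, hu, rfl⟩, rfl⟩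
    rw [mem_sphere_zero_iff_norm] at hu
    exact ⟨unitLog u, unitLog_mem_logUnits hu, (unitLog_image_closedBall p K hu).symm⟩
  · rintro _ ⟨z, hz, rfl⟩
    obtain ⟨v, hv, rfl⟩ := mem_logUnits_iff.mp hz
    exact ⟨closedBall v _, ⟨v, by rwa [mem_sphere_zero_iff_norm], rfl⟩, unitLog_image_closedBall p K hv⟩

include instK in
/-- **`R^μ ∩ (1 + p²R) = {1}` in ball form**: `ζ ↦ ζ·v + {‖z‖ ≤ p⁻²}` is injective on the roots of
unity (`v` a unit). [cite: Mochizuki2012, IUTchIV Prop. 1.4 (ii) proof p. 14] -/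
theorem injOn_torsion_ball {v : K} (hv : ‖v‖ = 1) :
    InjOn (fun ζ : K ↦ closedBall (ζ * v) ((p : ℝ) ^ (-(2 : ℝ)))) {ζ : K | IsTorsionUnit K ζ} := by
  intro ζ hζ ζ' hζ' h
  rw [mem_setOf_eq] at hζ hζ'
  have hζ1 : ‖ζ‖ = 1 := hζ.norm_eq_one
  have hζ0 : ζ ≠ 0 := norm_pos_iff.mp (by rw [hζ1]; exact one_pos)
  have hmem : ζ' * v ∈ closedBall (ζ * v) ((p : ℝ) ^ (-(2 : ℝ))) := by
    have : ζ' * v ∈ closedBall (ζ' * v) ((p : ℝ) ^ (-(2 : ℝ))) := mem_closedBall_self (rho_pos p).le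
    simp only at h
    rwa [← h] at this
  rw [mem_closedBall, dist_eq_norm] at hmem
  have hq : ‖1 - ζ⁻¹ * ζ'‖ ≤ (p : ℝ) ^ (-(2 : ℝ)) := by
    have : (1 : K) - ζ⁻¹ * ζ' = -(ζ⁻¹ * v⁻¹ * (ζ' * v - ζ * v)) := by
      have hv0 : v ≠ 0 := norm_pos_iff.mp (by rw [hv]; exact one_pos)
      field_simp
      ring
    rw [this, norm_neg, norm_mul, norm_mul, norm_inv, norm_inv, hζ1, hv, inv_one, one_mul, one_mul]
    exact hmem
  have htors : IsTorsionUnit K (ζ⁻¹ * ζ') := IsTorsionUnit.mul K (IsTorsionUnit.inv K hζ) hζ'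
  have h1 : ζ⁻¹ * ζ' = 1 := htors.eq_one_of_norm_one_sub_le p K (rpow_neg_two_mul_lt_one p) hq
  calc ζ = ζ * (ζ⁻¹ * ζ') := by rw [h1, mul_one]
    _ = ζ' := by rw [← mul_assoc, mul_inv_cancel₀ hζ0, one_mul]

include instK in
/-- **The fibres of `β ↦ log_p(β)`**: for a unit `v`, the `p⁻²`-balls of `R^×` mapped onto the ball
`log_p(v) + {‖z‖ ≤ p⁻²}` are exactly the balls `ζ·v + {‖z‖ ≤ p⁻²}`, `ζ ∈ R^μ` ("the log-volume on `R^×`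
determines … a log-volume on the quotient `R^× ↠ R^{×μ}`", proof of Prop. 1.4 (ii), pp. 13–14).
[cite: Mochizuki2012, IUTchIV Prop. 1.4 (ii) proof p. 14] -/
theorem fibre_eq_image_torsion {v : K} (hv : ‖v‖ = 1) :
    {β | β ∈ (fun x : K ↦ closedBall x ((p : ℝ) ^ (-(2 : ℝ)))) '' sphere (0 : K) 1 ∧
        unitLog '' β = closedBall (unitLog v) ((p : ℝ) ^ (-(2 : ℝ)))}
      = (fun ζ : K ↦ closedBall (ζ * v) ((p : ℝ) ^ (-(2 : ℝ)))) '' {ζ : K | IsTorsionUnit K ζ} := by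
  have hθ := rpow_neg_two_mul_lt_one p
  apply subset_antisymm
  · rintro β ⟨⟨u, hu, rfl⟩, hβ⟩
    rw [mem_sphere_zero_iff_norm] at hu
    rw [unitLog_image_closedBall p K hu] at hβ
    have hle : ‖unitLog u - unitLog v‖ ≤ (p : ℝ) ^ (-(2 : ℝ)) := by
      have : unitLog u ∈ closedBall (unitLog v) ((p : ℝ) ^ (-(2 : ℝ))) := by
        rw [← hβ]; exact mem_closedBall_self (rho_pos p).le
      rwa [mem_closedBall, dist_eq_norm] at this
    obtain ⟨ζ, w, hζ, hw, rfl⟩ := (unitLog_sub_norm_le_iff p K hθ hu hv).mp hle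
    refine ⟨ζ, hζ, IsUltrametricDist.closedBall_eq_of_mem ?_⟩
    rw [mem_closedBall, dist_eq_norm, show ζ * w * v - ζ * v = -(ζ * v * (1 - w)) by ring, norm_neg,
      norm_mul, norm_mul, hζ.norm_eq_one, hv, one_mul, one_mul]
    exact hw
  · rintro _ ⟨ζ, hζ, rfl⟩
    rw [mem_setOf_eq] at hζ
    have hζv : ‖ζ * v‖ = 1 := by rw [norm_mul, hζ.norm_eq_one, hv, one_mul]
    refine ⟨⟨ζ * v, by rwa [mem_sphere_zero_iff_norm], rfl⟩, ?_⟩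
    rw [unitLog_image_closedBall p K hζv, unitLog_mul p hζ.norm_eq_one hv]
    obtain ⟨n, hn, h1⟩ := hζ
    rw [unitLog_eq_zero_of_pow_eq_one p hn h1, zero_add]

include instK in
/-- **`R^μ` is finite** (`{ζ : IsTorsionUnit K ζ}`), as a by-product of the count: it injects into the
finite set of `p⁻²`-balls of the compact `R^×`. [claim: Mochizuki2012, status: disputed] -/
theorem finite_isTorsionUnit : {ζ : K | IsTorsionUnit K ζ}.Finite := by
  refine Finite.of_finite_image ?_ (injOn_torsion_ball p K norm_one)
  refine (finite_image_closedBall K (isCompact_sphere (0 : K) 1) (rho_pos p)).subset ?_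
  rintro _ ⟨ζ, hζ, rfl⟩
  rw [mem_setOf_eq] at hζ
  exact ⟨ζ * 1, by rw [mem_sphere_zero_iff_norm, mul_one]; exact hζ.norm_eq_one, rfl⟩

include instK in
/-- `R^μ` is nonempty (`1 ∈ R^μ`), so `#R^μ ≥ 1`. [claim: Mochizuki2012, status: disputed] -/
theorem ncard_isTorsionUnit_pos : 0 < {ζ : K | IsTorsionUnit K ζ}.ncard :=
  (ncard_pos (finite_isTorsionUnit p K)).mpr ⟨1, isTorsionUnit_one K⟩

include instK in
/-- **Counting balls**: `#{p⁻²-balls of R^×} = #{p⁻²-balls of log_p(R^×)} · #R^μ`.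
[cite: Mochizuki2012, IUTchIV Prop. 1.4 (ii) proof p. 14] -/
theorem ncard_balls_sphere_eq :
    ((fun x : K ↦ closedBall x ((p : ℝ) ^ (-(2 : ℝ)))) '' sphere (0 : K) 1).ncard
      = ((fun x : K ↦ closedBall x ((p : ℝ) ^ (-(2 : ℝ)))) '' logUnits K).ncard
          * {ζ : K | IsTorsionUnit K ζ}.ncard := by
  classical
  set ρ : ℝ := (p : ℝ) ^ (-(2 : ℝ)) with hρ
  have hfinS := finite_image_closedBall K (isCompact_sphere (0 : K) 1) (rho_pos p)
  have hfinT := finite_image_closedBall K (isCompact_logUnits p K) (rho_pos p)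
  set FS := hfinS.toFinset with hFS
  set FT := hfinT.toFinset with hFT
  have hmaps : ((FS : Set (Set K))).MapsTo (fun β : Set K ↦ unitLog '' β) (FT : Set (Set K)) := by
    intro β hβ
    rw [hFS, Finite.coe_toFinset] at hβ
    rw [hFT, Finite.coe_toFinset, ← image_unitLog_image_balls p K]
    exact mem_image_of_mem _ hβ
  have hcount := Finset.card_eq_sum_card_fiberwise hmaps
  have hfib : ∀ γ ∈ FT, (FS.filter (fun β ↦ unitLog '' β = γ)).card = {ζ : K | IsTorsionUnit K ζ}.ncard := by
    intro γ hγ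
    rw [hFT, Finite.mem_toFinset] at hγ
    obtain ⟨z, hz, rfl⟩ := hγ
    obtain ⟨v, hv, rfl⟩ := mem_logUnits_iff.mp hz
    rw [← (injOn_torsion_ball p K hv).ncard_image, ← fibre_eq_image_torsion p K hv, ← ncard_coe_finset]
    congr 1
    ext β
    simp [hFS, Finite.mem_toFinset]
  rw [Finset.sum_congr rfl hfib, Finset.sum_const, smul_eq_mul] at hcount
  rw [ncard_eq_toFinset_card _ hfinS, ncard_eq_toFinset_card _ hfinT]
  exact hcount

variable [MeasurableSpace K] [BorelSpace K]

include instK in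
/-- **[IUTchIV] Prop. 1.4 (ii), volume identity**: `μ_k(R^×) = #R^μ · μ_k(log_p(R^×))` for the
`O_k`-normalised Haar measure `μ_k` — "`μ^log(log_p(R^×_i)) = μ^log(R^{×μ}_i)`" with
`e_i f_i μ^log(R^{×μ}_i) = e_i f_i μ^log(R^×_i) − log(#R^μ_i)` (proof, pp. 13–14), in measure form.
[cite: Mochizuki2012, IUTchIV Prop. 1.4 (ii) p. 13] -/
theorem localVolume_sphere_eq_ncard_torsion_mul :
    localVolume K (sphere (0 : K) 1) = {ζ : K | IsTorsionUnit K ζ}.ncard * localVolume K (logUnits K) := by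
  have hS := localVolume_eq_ncard_mul K (isCompact_sphere (0 : K) 1) (rho_pos p)
    (fun u hu ↦ closedBall_subset_sphere p K (mem_sphere_zero_iff_norm.mp hu))
  have hT := localVolume_eq_ncard_mul K (isCompact_logUnits p K) (rho_pos p)
    (fun z hz ↦ closedBall_subset_logUnits_of_mem p K hz)
  rw [hS, hT, ncard_balls_sphere_eq p K, Nat.cast_mul]
  ring

include instK in
/-- The same identity in `ℝ`: `μ_k(log_p(R^×)) · #R^μ = μ_k(R^×) = 1 − q⁻¹`
(`localVolume_real_unitSphere`, abc-iut-S2). [cite: Mochizuki2012, IUTchIV Prop. 1.4 (ii) p. 13] -/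
theorem localVolume_real_logUnits_mul_ncard_torsion :
    (localVolume K (logUnits K)).toReal * {ζ : K | IsTorsionUnit K ζ}.ncard
      = 1 - ((residueCard K : ℝ))⁻¹ := by
  rw [← localVolume_real_unitSphere K, localVolume_sphere_eq_ncard_torsion_mul p K, ENNReal.toReal_mul,
    ENNReal.toReal_natCast, mul_comm]

include instK in
/-- **`μ_k(log_p(R^×)) = (1 − q⁻¹)/#R^μ`** as a real number. [cite: Mochizuki2012, IUTchIV Prop. 1.4 (ii) p. 13] -/
theorem localVolume_real_logUnits :
    (localVolume K (logUnits K)).toReal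
      = (1 - ((residueCard K : ℝ))⁻¹) / {ζ : K | IsTorsionUnit K ζ}.ncard := by
  have hN : (0 : ℝ) < {ζ : K | IsTorsionUnit K ζ}.ncard := by exact_mod_cast ncard_isTorsionUnit_pos p K
  rw [eq_div_iff hN.ne', localVolume_real_logUnits_mul_ncard_torsion p K]

include instK in
/-- `0 < μ_k(log_p(R^×)) < ∞` in `ℝ`: the real volume is positive.
[cite: Mochizuki2012, IUTchIV Prop. 1.4 (ii) p. 13] -/
theorem localVolume_real_logUnits_pos : 0 < (localVolume K (logUnits K)).toReal := by
  rw [localVolume_real_logUnits p K]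
  exact div_pos (one_sub_inv_residueCard_pos K) (by exact_mod_cast ncard_isTorsionUnit_pos p K)

include instK in
/-- **`μ^log_k(log_p(R^×)) = log(1 − q⁻¹) − log #R^μ`** (un-normalised log-volume; the printed
"`e_i f_i μ^log(R^{×μ}_i) = e_i f_i μ^log(R^×_i) − log(p^{m_i}·(p^{f_i} − 1))`", proof p. 14).
[cite: Mochizuki2012, IUTchIV Prop. 1.4 (ii) proof p. 14] -/
theorem localLogVolume_logUnits :
    localLogVolume K (logUnits K)
      = Real.log (1 - ((residueCard K : ℝ))⁻¹) - Real.log ({ζ : K | IsTorsionUnit K ζ}.ncard : ℝ) := by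
  have hN : (0 : ℝ) < {ζ : K | IsTorsionUnit K ζ}.ncard := by exact_mod_cast ncard_isTorsionUnit_pos p K
  rw [localLogVolume_eq_log, localVolume_real_logUnits p K,
    Real.log_div (one_sub_inv_residueCard_pos K).ne' hN.ne']

end Log

end Literature.IUT.LogVolume

end
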